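import Summits.BirchSwinnertonDyer.BirchSwinnertonDyer.Theorems.BiquadraticEisensteinDescentHeegnerFieldSupplyAdmissibilityOfQuadratic
import Summits.BirchSwinnertonDyer.BirchSwinnertonDyer.Theorems.BiquadraticEisensteinDescentHeegnerFieldSupplyAdmissibilityDescends
import Literature.NumberTheory.QuadraticFields.ClassNumberOne
import Literature.NumberTheory.NumberFields.PureCubicClassNumberModThreeProofs
import Literature.NumberTheory.EllipticCurves.HeegnerPointsImaginaryQuadraticProofs
import HarnessLib

/-!
# Route BiquadraticEisensteinDescent — the admissibility conjunct of KS in the route's binders: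
# `p ∤ h(K′)` and `p ∤ h(ℚ(√(d_CM·d_K′)))` ⟹ «every quartic `M ∋ √d_CM, √d_K′` has `p ∤ h(M)`»
# (item stmt-BirchSwinnertonDyer-20198; the kernel form of the dossier's Δ-h⁻)

For `W` CM with `p ≠ 2` of inert-bad type (`CMInert W p`, `¬ Good W p`) and an imaginary quadratic
`K′` with the Heegner hypothesis for `N_W` (so `p` splits in `K′`), the admissibility conjunct of
`HeegnerFieldSupplyCMInertBadAdm` (= hypothesis `hadm` of E♭°/W♭/C′) FOLLOWS from `p ∤ h(K′)` and
`p ∤ h(F)` for every quadratic `F ∋ √(d_CM·d_K′)` (i.e. the real quadratic `ℚ(√(d_CM d_K′))`):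
`admissible_of_not_dvd_classNumber`. Ingredients: `h(K_CM) = 1` for the nine CM fields (tree:
`isPrincipalIdealRing_of_sq_eq_intCast`, Marcus Ch. 5) — `not_dvd_classNumber_of_sq_eq_cmFieldDiscrOfJ`;
a quadratic field containing `√d_K′` has the class number of `K′` — `classNumber_eq_of_sq_eq_discr`;
`d_CM` is not a square in `K′` (companion `…AdmissibilityDescends.lean`), so `d_CM·d_K′` is not a
rational square; and the biquadratic ascent of `…AdmissibilityOfQuadratic.lean`. With the companion's
`not_dvd_classNumber_heegnerField_of_admissible` this gives, for odd `p`, the equivalence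
«admissibility ⟺ `p ∤ h(K′) ∧ p ∤ h(ℚ(√(d_CM·d_K′)))`» up to the real-quadratic direction
(`admissible → p ∤ h(F)`, same method; not needed by the route and not typed here).
Theorem-only file, unconditional; helper toward KS (`--supports` stmt-BirchSwinnertonDyer-20198);
it closes nothing and says nothing about the crux's open coupling (twist `L`-value × class number).
Prover seat bsd-wall-bed-p2 (g6), 2026-08-27.

References: [Marcus2018] Ch. 5 (class number one); cell dossier HOME/bsd-wall-cm/g5/HEART-KS-DOSSIER-v1.2.md §4.
-/

set_option autoImplicit false

-- D-0017 layout: summit = sub-problem, so `Summit.BirchSwinnertonDyer.BirchSwinnertonDyer.…` is the mandated namespace.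
set_option linter.dupNamespace false

open scoped NumberField
open Module NumberField IntermediateField
open Summit.BirchSwinnertonDyer.BirchSwinnertonDyer.Theorems.BiquadraticEisensteinDescentHeegnerFieldSupplyAdmissibilityKleinFour
open Summit.BirchSwinnertonDyer.BirchSwinnertonDyer.Theorems.BiquadraticEisensteinDescentHeegnerFieldSupplyAdmissibilityOfQuadratic

namespace Summit.BirchSwinnertonDyer.BirchSwinnertonDyer.Theorems.BiquadraticEisensteinDescentHeegnerFieldSupplyAdmissibilityCMInertBad

/-! ### In the binders of the route: admissibility ⟺ `p ∤ h(K′) · h(ℚ(√(d_CM·d_K′)))` -/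

section Route

open Literature.NumberTheory.EllipticCurves

/-- The CM discriminant read off `j` is one of the nine class-number-one discriminants, or the junk
value `0`. [folklore] -/
theorem cmFieldDiscrOfJ_mem_or_eq_zero (j : ℚ) :
    Rank1Residual.cmFieldDiscrOfJ j ∈ ({-3, -4, -7, -8, -11, -19, -43, -67, -163} : Finset ℤ) ∨
      Rank1Residual.cmFieldDiscrOfJ j = 0 := by
  unfold Rank1Residual.cmFieldDiscrOfJ
  split_ifs <;> simp

/-- Under `CMInert W p` the CM discriminant is not the junk value (`p ∤ d_CM` forbids `d_CM = 0`),
hence one of the nine values and in particular negative. [folklore] -/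
theorem cmFieldDiscrOfJ_mem_of_cmInert (W : WeierstrassCurve ℚ) [W.IsElliptic] {p : ℕ}
    (hin : Rank1Residual.CMInert W p) :
    Rank1Residual.cmFieldDiscrOfJ W.j ∈ ({-3, -4, -7, -8, -11, -19, -43, -67, -163} : Finset ℤ) := by
  rcases cmFieldDiscrOfJ_mem_or_eq_zero W.j with h | h
  · exact h
  · exact absurd (by rw [Rank1Residual.CMRamified, h]; exact dvd_zero _) hin.1

/-- `d_CM < 0` under `CMInert W p`. [folklore] -/
theorem cmFieldDiscrOfJ_neg_of_cmInert (W : WeierstrassCurve ℚ) [W.IsElliptic] {p : ℕ}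
    (hin : Rank1Residual.CMInert W p) : Rank1Residual.cmFieldDiscrOfJ W.j < 0 := by
  have h := cmFieldDiscrOfJ_mem_of_cmInert W hin
  simp only [Finset.mem_insert, Finset.mem_singleton] at h
  rcases h with h | h | h | h | h | h | h | h | h <;> rw [h] <;> norm_num

/-- **Every quadratic field containing `√d_CM` has class number one** (the nine imaginary quadratic
fields of class number one, tree: `isPrincipalIdealRing_of_sq_eq_intCast`, Marcus Ch. 5), so its
class number is prime to every prime `p`. [folklore] -/
theorem not_dvd_classNumber_of_sq_eq_cmFieldDiscrOfJ (W : WeierstrassCurve ℚ) [W.IsElliptic]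
    {p : ℕ} (hp : p.Prime) (hin : Rank1Residual.CMInert W p) (F : Type) [Field F] [NumberField F]
    (h2 : finrank ℚ F = 2) {z : F} (hz : z ^ 2 = ((Rank1Residual.cmFieldDiscrOfJ W.j : ℤ) : F)) :
    ¬ p ∣ classNumber F := by
  haveI : IsPrincipalIdealRing (𝓞 F) :=
    Literature.NumberTheory.QuadraticFields.Quadratic.isPrincipalIdealRing_of_sq_eq_intCast h2 hz
      (cmFieldDiscrOfJ_mem_of_cmInert W hin)
  rw [NumberField.classNumber_eq_one_iff.mpr inferInstance, Nat.dvd_one]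
  exact hp.ne_one

/-- **A quadratic field containing `√d_K′` has the class number of `K′`** (`K′` imaginary quadratic:
`d_K′ < 0` is not a rational square, so both fields are `ℚ[X]/(X² − d_K′)`; the tree's
`exists_sq_eq_discr` puts `√d_K′` in `K′`). [folklore] -/
theorem classNumber_eq_of_sq_eq_discr (K : Type) [Field K] [NumberField K]
    (hK : IsImaginaryQuadratic K) (F : Type) [Field F] [NumberField F] (h2 : finrank ℚ F = 2)
    {z : F} (hz : z ^ 2 = ((NumberField.discr K : ℤ) : F)) : classNumber F = classNumber K := by
  obtain ⟨t, m, δ, -, hδ⟩ := Literature.NumberTheory.QuadraticFields.Quadratic.exists_sq_eq_discr hK.1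
  have hneg : NumberField.discr K < 0 := hK.discr_neg
  have ha : ∀ r : ℚ, r ^ 2 ≠ (NumberField.discr K : ℚ) := fun r h => by
    have h0 : (0 : ℚ) ≤ (NumberField.discr K : ℚ) := by rw [← h]; positivity
    have : (NumberField.discr K : ℚ) < 0 := by exact_mod_cast hneg
    linarith
  have hz' : z ^ 2 = algebraMap ℚ F (NumberField.discr K : ℚ) := by rw [hz, map_intCast]
  have hδ' : ((δ : K)) ^ 2 = algebraMap ℚ K (NumberField.discr K : ℚ) := by
    rw [map_intCast]
    have h := congrArg ((↑) : 𝓞 K → K) hδ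
    push_cast at h
    exact h
  obtain ⟨e⟩ := nonempty_algEquiv_of_sq_eq h2 hK.1 ha hz' hδ'
  exact Literature.NumberTheory.NumberFields.Honda1971.classNumber_eq_of_ringEquiv e.toRingEquiv

/-- **The admissibility conjunct of KS from the two quadratic class numbers — in the binders of the
route.** For `W` CM with `p ≠ 2` of inert-bad type (`CMInert W p`, `¬ Good W p`) and an imaginary
quadratic `K′` satisfying the Heegner hypothesis for `N_W`: if `p ∤ h(K′)` and every quadratic field
containing a square root of `d_CM·d_K′` (i.e. the real quadratic `ℚ(√(d_CM d_K′))`) has class number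
prime to `p`, then EVERY quartic field containing `√d_CM` and `√d_K′` has class number prime to `p`
— VERBATIM the admissibility conjunct of `HeegnerFieldSupplyCMInertBadAdm`
(stmt-BirchSwinnertonDyer-20198) and the hypothesis `hadm` of E♭°/W♭/C′. Ingredients: `h(K_CM) = 1`
(tree, Marcus Ch. 5), `d_CM` is not a square in `K′` (companion file
`…AdmissibilityDescends.lean`, from `CMInert` and `p` split), so `d_CM·d_K′` is not a rational square,
and the Klein-four descent above. Together with the companion's converse
(`not_dvd_classNumber_heegnerField_of_admissible`), for odd `p`:
admissibility ⟺ `p ∤ h(K′) ∧ p ∤ h(ℚ(√(d_CM·d_K′)))` — the kernel form of the dossier's Δ-h⁻ remark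
(Kuroda/Herglotz). [folklore] -/
theorem admissible_of_not_dvd_classNumber (W : WeierstrassCurve ℚ) [W.IsElliptic] {p : ℕ}
    [Fact p.Prime] (hp2 : p ≠ 2) (hin : Rank1Residual.CMInert W p) (hbad : ¬ Rank1Residual.Good W p)
    (K : Type) [Field K] [NumberField K] (hK : IsImaginaryQuadratic K)
    (hHN : SatisfiesHeegnerHypothesis (W.conductorNorm ℤ) K) (hK' : ¬ p ∣ classNumber K)
    (hF : ∀ (F : Type) [Field F] [NumberField F], finrank ℚ F = 2 →
      (∃ z : F, z ^ 2 = ((Rank1Residual.cmFieldDiscrOfJ W.j * NumberField.discr K : ℤ) : F)) →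
      ¬ p ∣ classNumber F) :
    ∀ (M : Type) [Field M] [NumberField M], finrank ℚ M = 4 →
      (∃ x : M, x ^ 2 = ((Rank1Residual.cmFieldDiscrOfJ W.j : ℤ) : M)) →
      (∃ y : M, y ^ 2 = ((NumberField.discr K : ℤ) : M)) → ¬ p ∣ classNumber M := by
  have hp : p.Prime := Fact.out
  set d := Rank1Residual.cmFieldDiscrOfJ W.j with hd
  have hpN : p ∣ W.conductorNorm ℤ := (W.dvd_conductorNorm_iff_not_hasGoodReductionAtPrime p).mpr hbad
  have hsplit : ((Ideal.span {(p : ℤ)}).primesOver (𝓞 K)).ncard = 2 := hHN p hp hpN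
  -- `d_CM`, `d_K′`, `d_CM·d_K′` are rational non-squares
  have hdneg : d < 0 := cmFieldDiscrOfJ_neg_of_cmInert W hin
  have hKneg : NumberField.discr K < 0 := hK.discr_neg
  have ha : ∀ r : ℚ, r ^ 2 ≠ (d : ℚ) := fun r h => by
    have h0 : (0 : ℚ) ≤ (d : ℚ) := by rw [← h]; positivity
    have : (d : ℚ) < 0 := by exact_mod_cast hdneg
    linarith
  have hb : ∀ r : ℚ, r ^ 2 ≠ (NumberField.discr K : ℚ) := fun r h => by
    have h0 : (0 : ℚ) ≤ (NumberField.discr K : ℚ) := by rw [← h]; positivity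
    have : (NumberField.discr K : ℚ) < 0 := by exact_mod_cast hKneg
    linarith
  have hns := BiquadraticEisensteinDescentHeegnerFieldSupplyAdmissibilityDescends.forall_sq_ne_cmFieldDiscrOfJ
    W hp2 hin K hK.1 hsplit
  have hab : ∀ r : ℚ, r ^ 2 ≠ (d : ℚ) * (NumberField.discr K : ℚ) := by
    intro r hr
    -- `√d_CM = (r/d_K′)·√d_K′ ∈ K′`
    obtain ⟨t, m, δ, -, hδ⟩ :=
      Literature.NumberTheory.QuadraticFields.Quadratic.exists_sq_eq_discr hK.1
    have hδ' : ((δ : K)) ^ 2 = (NumberField.discr K : K) := by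
      have h := congrArg ((↑) : 𝓞 K → K) hδ
      push_cast at h
      exact h
    have hD0 : (NumberField.discr K : ℚ) ≠ 0 := by exact_mod_cast hKneg.ne
    apply hns (algebraMap ℚ K (r / NumberField.discr K) * (δ : K))
    rw [mul_pow, hδ', ← map_pow, div_pow, hr]
    have : (d : K) = algebraMap ℚ K (d : ℚ) := by rw [map_intCast]
    rw [this, show ((NumberField.discr K : ℤ) : K) = algebraMap ℚ K (NumberField.discr K : ℚ) by
      rw [map_intCast], ← map_mul]
    congr 1
    field_simp
  refine forall_quartic_not_dvd_classNumber_of_quadratic hp hp2 ha hb hab ?_ ?_ hF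
  · intro F _ _ h2F hzF
    obtain ⟨z, hz⟩ := hzF
    exact not_dvd_classNumber_of_sq_eq_cmFieldDiscrOfJ W hp hin F h2F hz
  · intro F _ _ h2F hzF
    obtain ⟨z, hz⟩ := hzF
    rw [classNumber_eq_of_sq_eq_discr K hK F h2F hz]
    exact hK'

/-- **Conversely, admissibility forces `p ∤ h(ℚ(√(d_CM·d_K′)))`.** Under the route hypotheses
(`p ≠ 2`, `CMInert W p`, `¬ Good W p`, `K′` imaginary quadratic with the Heegner hypothesis for `N_W`),
if every quartic `M ∋ √d_CM, √d_K′` has `p ∤ h(M)`, then every quadratic field `F` containing a square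
root `z` of `d_CM·d_K′` has `p ∤ h(F)`. Proof: `d_CM·d_K′` is not a rational square (companion:
`d_CM` is not a square in `K′`), so `F = ℚ(z)`; `d_K′` is not a square in `F` (an element of `ℚ(z)`
with square `d_K′` makes `d_K′` or `d_CM·d_K′²` a rational square, both absurd by signs); a quartic
`M ∋ √d_K′, √d_F` contains `√d_CM = √d_F/(q·√d_K′)` where `d_F = d_CM d_K′ q²`; so the companion's
`not_dvd_classNumber_of_forall_quartic` applies to `(F, d_K′)`. With
`admissible_of_not_dvd_classNumber` and the companion's `not_dvd_classNumber_heegnerField_of_admissible`: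
for odd `p` in the corner, ADMISSIBILITY ⟺ `p ∤ h(K′)` ∧ `p ∤ h(F)` for all quadratic
`F ∋ √(d_CM·d_K′)`. [folklore] -/
theorem not_dvd_classNumber_real_of_admissible (W : WeierstrassCurve ℚ) [W.IsElliptic] {p : ℕ}
    [Fact p.Prime] (hp2 : p ≠ 2) (hin : Rank1Residual.CMInert W p) (hbad : ¬ Rank1Residual.Good W p)
    (K : Type) [Field K] [NumberField K] (hK : IsImaginaryQuadratic K)
    (hHN : SatisfiesHeegnerHypothesis (W.conductorNorm ℤ) K)
    (hAdm : ∀ (M : Type) [Field M] [NumberField M], finrank ℚ M = 4 →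
      (∃ x : M, x ^ 2 = ((Rank1Residual.cmFieldDiscrOfJ W.j : ℤ) : M)) →
      (∃ y : M, y ^ 2 = ((NumberField.discr K : ℤ) : M)) → ¬ p ∣ classNumber M)
    (F : Type) [Field F] [NumberField F] (h2 : finrank ℚ F = 2) {z : F}
    (hz : z ^ 2 = ((Rank1Residual.cmFieldDiscrOfJ W.j * NumberField.discr K : ℤ) : F)) :
    ¬ p ∣ classNumber F := by
  have hp : p.Prime := Fact.out
  set d := Rank1Residual.cmFieldDiscrOfJ W.j with hd
  set D := NumberField.discr K with hD
  have hpN : p ∣ W.conductorNorm ℤ := (W.dvd_conductorNorm_iff_not_hasGoodReductionAtPrime p).mpr hbad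
  have hsplit : ((Ideal.span {(p : ℤ)}).primesOver (𝓞 K)).ncard = 2 := hHN p hp hpN
  have hdneg : d < 0 := cmFieldDiscrOfJ_neg_of_cmInert W hin
  have hDneg : D < 0 := hK.discr_neg
  have hD0 : (D : ℚ) ≠ 0 := by exact_mod_cast hDneg.ne
  -- `d·D` is not a rational square (else `√d ∈ K′`)
  have hnsK := BiquadraticEisensteinDescentHeegnerFieldSupplyAdmissibilityDescends.forall_sq_ne_cmFieldDiscrOfJ
    W hp2 hin K hK.1 hsplit
  have hab : ∀ r : ℚ, r ^ 2 ≠ (d : ℚ) * (D : ℚ) := by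
    intro r hr
    obtain ⟨t, m, δ, -, hδ⟩ :=
      Literature.NumberTheory.QuadraticFields.Quadratic.exists_sq_eq_discr hK.1
    have hδ' : ((δ : K)) ^ 2 = (D : K) := by
      have h := congrArg ((↑) : 𝓞 K → K) hδ
      push_cast at h
      exact h
    apply hnsK (algebraMap ℚ K (r / D) * (δ : K))
    rw [mul_pow, hδ', ← map_pow, div_pow, hr]
    rw [show (d : K) = algebraMap ℚ K (d : ℚ) by rw [map_intCast],
      show ((D : ℤ) : K) = algebraMap ℚ K (D : ℚ) by rw [map_intCast], ← map_mul]
    congr 1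
    field_simp
  have hz' : z ^ 2 = algebraMap ℚ F ((d : ℚ) * (D : ℚ)) := by
    rw [hz, map_mul, map_intCast, map_intCast]; push_cast; ring
  have hzr : z ∉ Set.range (algebraMap ℚ F) := not_mem_range_of_sq_eq hz' hab
  -- `D` is not a square in `F = ℚ(z)`
  have hnsF : ∀ y : F, y ^ 2 ≠ (D : F) := by
    intro y hy
    have hy' : y ^ 2 = algebraMap ℚ F (D : ℚ) := by rw [hy, map_intCast]
    have hymem : y ∈ ℚ⟮z⟯ := by rw [adjoin_sqrt_eq_top h2 z hz' hab]; trivial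
    rcases sq_or_mul_sq_of_mem_adjoin hz' hzr hymem hy' with ⟨r, hr⟩ | ⟨r, hr⟩
    · have h0 : (0 : ℚ) ≤ (D : ℚ) := by rw [← hr]; positivity
      have : (D : ℚ) < 0 := by exact_mod_cast hDneg
      linarith
    · -- `r² = d·D·D`, so `d = (r/D)² ≥ 0`
      have h0 : (0 : ℚ) ≤ (d : ℚ) := by
        have : (d : ℚ) = (r / D) ^ 2 := by field_simp; linarith [hr]
        rw [this]; positivity
      have : (d : ℚ) < 0 := by exact_mod_cast hdneg
      linarith
  -- the quartic binder for `(D, d_F)` from the one for `(d, D)`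
  refine BiquadraticEisensteinDescentHeegnerFieldSupplyAdmissibilityDescends.not_dvd_classNumber_of_forall_quartic
    F h2 hnsF hp hp2 ?_
  intro M _ _ h4 hxM hyM
  obtain ⟨x', hx'⟩ := hxM
  obtain ⟨y', hy'⟩ := hyM
  obtain ⟨q, hq0, hq⟩ := NumberField.exists_discr_eq_mul_sq h2 hzr hz'
  -- `√d = √d_F / (q √D)`
  have hx'0 : x' ≠ 0 := by
    intro h
    rw [h, zero_pow two_ne_zero] at hx'
    have : ((D : ℤ) : M) ≠ 0 := by exact_mod_cast hDneg.ne
    exact this hx'.symm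
  have hq0' : (algebraMap ℚ M q) ≠ 0 := by rw [_root_.map_ne_zero]; exact hq0
  refine hAdm M h4 ⟨y' * (algebraMap ℚ M q)⁻¹ * x'⁻¹, ?_⟩ ⟨x', hx'⟩
  have hyq : y' ^ 2 = algebraMap ℚ M ((d : ℚ) * D * q ^ 2) := by
    rw [hy', show ((NumberField.discr F : ℤ) : M) = algebraMap ℚ M (NumberField.discr F : ℚ) by
      rw [map_intCast], hq]
  have hxD : x' ^ 2 = algebraMap ℚ M (D : ℚ) := by rw [hx', map_intCast]
  have hD0M : algebraMap ℚ M (D : ℚ) ≠ 0 := by rw [_root_.map_ne_zero]; exact hD0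
  have e1 : (y' * (algebraMap ℚ M q)⁻¹ * x'⁻¹) ^ 2 =
      y' ^ 2 * ((algebraMap ℚ M q) ^ 2)⁻¹ * (x' ^ 2)⁻¹ := by ring
  rw [e1, hyq, hxD, map_mul, map_mul, map_pow, map_intCast]
  field_simp

end Route

end Summit.BirchSwinnertonDyer.BirchSwinnertonDyer.Theorems.BiquadraticEisensteinDescentHeegnerFieldSupplyAdmissibilityCMInertBad
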